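import Mathlib
import Literature.Computability.AlgebraicComplexity.LocalStrongUSP

/-!
# `ThinBlockAlpha.SkewLocalStrongUSP`, line `Concat`: `stub_concatWitness`

Support file for crux item `stmt-MatrixMultiplication-10598`
(`Summit.MatrixMultiplication.MatrixMultiplication.Theses.ThinBlockAlpha.SkewLocalStrongUSP`), line
`Concat` (graded tilted alphabets), registered stub `stub_concatWitness` — the CONCATENATION STEP:
over a tilted alphabet, three constant-composition words not all equal have an admissible column.

Setting.  An alphabet of letters `e x : Fin b → Fin 3` (`x : Fin N`) is *tilted* by rational
potentials `f g h : Fin N → ℚ` with `f x + g x + h x = 0` for every letter and `0 < f x + g y + h z`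
for every triple of letters `(x, y, z)` not all equal that FAILS (no position of the width-`b` letters
carries a pattern of `localStrongUSPPatterns`, CKSU 2005 §6.1).  Words `ω : Fin m → Fin N` are
concatenated blockwise (block `j` carries the letter `e (ω j)`).

* `sum_comp_eq_sum_card_mul` — fibrewise summation: `∑ j, φ (ω j) = ∑ x, #{j | ω j = x} · φ x`.
* `stub_concatWitness` — three words with the same composition, not all equal, have an admissible
  column `p = (block, position)`.

Proof.  If every column failed, every block `j` would be a failing letter triple, so the block sum
`S := ∑ j, (f (ω₁ j) + g (ω₂ j) + h (ω₃ j))` has every summand `≥ 0` (a block with equal letters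
contributes `f x + g x + h x = 0`, any other block is positive by the tilt) and one summand `> 0`
(the words are not all equal, so some block has letters not all equal): `S > 0`.  But fibrewise
`S = ∑ x, #{j | ω₁ j = x} f x + #{j | ω₂ j = x} g x + #{j | ω₃ j = x} h x`, and the three counts agree
by constant composition, so `S = ∑ x, cₓ (f x + g x + h x) = 0`.  Mathlib only
(`Finset.sum_fiberwise'`, `Finset.sum_pos'`).
-/

set_option linter.dupNamespace false

namespace Summit.MatrixMultiplication.MatrixMultiplication.Theorems.SkewLocalStrongUSP

open Finset
open Literature.Computability.AlgebraicComplexity (localStrongUSPPatterns)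

/-- Fibrewise summation along a word: `∑ j, φ (ω j) = ∑ x, #{j | ω j = x} · φ x`. -/
theorem sum_comp_eq_sum_card_mul {m N : ℕ} (ω : Fin m → Fin N) (φ : Fin N → ℚ) :
    ∑ j, φ (ω j) = ∑ x, ((univ.filter fun j => ω j = x).card : ℚ) * φ x := by
  rw [← Finset.sum_fiberwise' univ ω φ]
  refine Finset.sum_congr rfl fun x _ => ?_
  rw [Finset.sum_const, nsmul_eq_mul]

/-- **stub_concatWitness** — over a tilted alphabet `(e, f, g, h)`, three words `ω₁ ω₂ ω₃` with the
same composition (every letter occurs equally often in each) and not all equal have a column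
`p = (block, position)` whose pattern `(e (ω₁ p.1) p.2, e (ω₂ p.1) p.2, e (ω₃ p.1) p.2)` is admissible.
(Sum the potential over the blocks: it vanishes by constant composition, yet under failure every block
contributes `≥ 0` and a block with letters not all equal contributes `> 0`.) -/
theorem stub_concatWitness :
    ∀ (N b m : ℕ) (e : Fin N → Fin b → Fin 3) (f g h : Fin N → ℚ),
      (∀ x, f x + g x + h x = 0) →
      (∀ x y z, (x ≠ y ∨ y ≠ z) → (∀ i, (e x i, e y i, e z i) ∉ localStrongUSPPatterns) →
        0 < f x + g y + h z) →
      ∀ (ω₁ ω₂ ω₃ : Fin m → Fin N),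
        (∀ x, (univ.filter fun j => ω₁ j = x).card = (univ.filter fun j => ω₂ j = x).card) →
        (∀ x, (univ.filter fun j => ω₂ j = x).card = (univ.filter fun j => ω₃ j = x).card) →
        (ω₁ ≠ ω₂ ∨ ω₂ ≠ ω₃) →
        ∃ p : Fin m × Fin b, (e (ω₁ p.1) p.2, e (ω₂ p.1) p.2, e (ω₃ p.1) p.2) ∈ localStrongUSPPatterns := by
  intro N b m e f g h hsum htilt ω₁ ω₂ ω₃ h12 h23 hne
  by_contra hcon
  push Not at hcon
  -- (1) the block sum vanishes, by constant composition
  have hS0 : ∑ j, (f (ω₁ j) + g (ω₂ j) + h (ω₃ j)) = 0 := by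
    rw [Finset.sum_add_distrib, Finset.sum_add_distrib, sum_comp_eq_sum_card_mul ω₁ f,
      sum_comp_eq_sum_card_mul ω₂ g, sum_comp_eq_sum_card_mul ω₃ h, ← Finset.sum_add_distrib,
      ← Finset.sum_add_distrib]
    refine Finset.sum_eq_zero fun x _ => ?_
    rw [h12 x, h23 x, ← mul_add, ← mul_add, hsum x, mul_zero]
  -- (2) the block sum is positive, by the tilt (every block fails)
  have hj : ∃ j, ω₁ j ≠ ω₂ j ∨ ω₂ j ≠ ω₃ j := by
    by_contra hall
    push Not at hall
    rcases hne with h₁ | h₂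
    · exact h₁ (funext fun j => (hall j).1)
    · exact h₂ (funext fun j => (hall j).2)
  have hSpos : 0 < ∑ j, (f (ω₁ j) + g (ω₂ j) + h (ω₃ j)) := by
    obtain ⟨j₀, hj₀⟩ := hj
    refine Finset.sum_pos' (fun j _ => ?_) ⟨j₀, mem_univ _, htilt _ _ _ hj₀ fun i => hcon (j₀, i)⟩
    by_cases hjj : ω₁ j ≠ ω₂ j ∨ ω₂ j ≠ ω₃ j
    · exact le_of_lt (htilt _ _ _ hjj fun i => hcon (j, i))
    · push Not at hjj
      rw [hjj.1, hjj.2, hsum]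
  exact absurd hS0 (ne_of_gt hSpos)

end Summit.MatrixMultiplication.MatrixMultiplication.Theorems.SkewLocalStrongUSP
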